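import Mathlib

/-!
# Cohn 1996, «Perfect Pell powers», LEMMA (odd exponent) — the Pell half

J. H. E. Cohn, *Perfect Pell powers*, Glasgow Math. J. 38 (1996) 19–20, proof of the LEMMA for odd
`k = 2K+1`, second half (p. 20, lines 3–13): once the Gaussian-integer step has produced `2z = c² + 1`,
the equation `y² + 1 = 2 z^{2K+1}` reads `y² − (c²+1)(z^K)² = −1`; every solution of the negative
Pell equation `u² − (c²+1) v² = −1` is `u + v√(c²+1) = ± (c + √(c²+1))^{2m+1}`, so
`z^K = V_m := ∑_{j=0}^{m} C(2m+1, 2j+1) c^{2(m−j)} (c²+1)^j`; comparing `p`-adic valuations for the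
primes `p ∣ z` (all `≥ 5`) gives `z^K ∣ 2m+1`, while `V_m > 2m+1` for `m ≥ 1`; hence `m = 0`, `z = 1`.

This file proves the three Pell-side inputs of that argument, all with elementary statements:

* `cohn_negPell_structure` (B): structure of the negative Pell equation for `D = c² + 1`
  (fundamental solution `(2c²+1, 2c)` of the `+1` equation via Mathlib's `Pell.IsFundamental`,
  the binomial expansion of `(c + √D)^{2m+1}` in `ℤ√D`);
* `cohn_pow_dvd_index` (C): the `p`-adic comparison `z^K ∣ 2m+1`;
* `cohn_index_lt_sum` (D): the size bound `2m+1 < V_m` for `m ≥ 1`.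

PROOF-ONLY helper file for the input row I-03 (odd half) behind `Summit.ABC.ABC.Theses…SolvedZooABC`
(stmt-ABC-24025, family (ii)); no definition, no named fact, no `sorry`. Proving this printed input makes a
conditional line unconditional AS TYPED; it is not abc and moves abc by 0.
[cite: paper:cohn1996-perfect-pell-powers, Lemma, p. 19–20]
-/

set_option linter.dupNamespace false

namespace Summit.ABC.ABC.Theorems

open Finset Zsqrtd

/-! ## Binomial expansion of `(c + √d)^n` in `ℤ√d` -/

/-- `im` commutes with finite sums in `ℤ√d`. -/
theorem cohnPell_im_sum {d : ℤ} {ι : Type*} (s : Finset ι) (f : ι → ℤ√d) :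
    (∑ i ∈ s, f i).im = ∑ i ∈ s, (f i).im := by
  induction s using Finset.cons_induction with
  | empty => simp
  | cons a s ha ih => simp [ih]

/-- `(√d)^(2j) = d^j` in `ℤ√d`. -/
theorem cohnPell_sqrtd_pow_two_mul {d : ℤ} (j : ℕ) :
    (sqrtd : ℤ√d) ^ (2 * j) = ((d ^ j : ℤ) : ℤ√d) := by
  rw [pow_mul, pow_two, dmuld, Int.cast_pow]

/-- The `√d`-coordinate of `(√d)^k`: `d^{(k-1)/2}` for odd `k`, `0` for even `k`. -/
theorem cohnPell_im_sqrtd_pow {d : ℤ} (k : ℕ) :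
    ((sqrtd : ℤ√d) ^ k).im = if Odd k then d ^ (k / 2) else 0 := by
  rcases Nat.even_or_odd k with ⟨j, rfl⟩ | ⟨j, rfl⟩
  · have h1 : ¬ Odd (j + j) := by rw [Nat.not_odd_iff_even]; exact ⟨j, rfl⟩
    have h2 : ((sqrtd : ℤ√d) ^ (j + j)) = ((d ^ j : ℤ) : ℤ√d) := by
      rw [← two_mul, cohnPell_sqrtd_pow_two_mul]
    rw [h2, im_intCast, if_neg h1]
  · have h1 : Odd (2 * j + 1) := odd_two_mul_add_one j
    have h2 : ((sqrtd : ℤ√d) ^ (2 * j + 1)) = ((d ^ j : ℤ) : ℤ√d) * sqrtd := by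
      rw [pow_succ, cohnPell_sqrtd_pow_two_mul]
    have h3 : (2 * j + 1) / 2 = j := by omega
    rw [h2, im_mul, re_intCast, im_intCast, im_sqrtd, re_sqrtd, if_pos h1, h3]
    ring

/-- Binomial theorem for `(c + √d)^n`, `√d`-coordinate. -/
theorem cohnPell_im_pow_eq_sum {d : ℤ} (c : ℤ) (n : ℕ) :
    ((⟨c, 1⟩ : ℤ√d) ^ n).im =
      ∑ k ∈ range (n + 1), (if Odd k then d ^ (k / 2) else 0) * c ^ (n - k) * (n.choose k) := by
  have hε : (⟨c, 1⟩ : ℤ√d) = sqrtd + (c : ℤ√d) := by ext <;> simp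
  rw [hε, add_pow, cohnPell_im_sum]
  refine sum_congr rfl fun k _ => ?_
  have : (sqrtd : ℤ√d) ^ k * (c : ℤ√d) ^ (n - k) * (n.choose k : ℤ√d)
      = (sqrtd : ℤ√d) ^ k * ((c ^ (n - k) * n.choose k : ℤ) : ℤ√d) := by push_cast; ring
  rw [this, im_mul, re_intCast, im_intCast, cohnPell_im_sqrtd_pow]
  ring

/-- Splitting a sum over `range (2m)` into even and odd indices. -/
theorem cohnPell_sum_range_two_mul {M : Type*} [AddCommMonoid M] (f : ℕ → M) (m : ℕ) :
    ∑ k ∈ range (2 * m), f k = ∑ j ∈ range m, (f (2 * j) + f (2 * j + 1)) := by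
  induction m with
  | zero => simp
  | succ m ih =>
    rw [show 2 * (m + 1) = 2 * m + 1 + 1 by ring, sum_range_succ, sum_range_succ, ih,
      sum_range_succ, add_assoc]

/-- `Im (c + √d)^{2m+1} = ∑_{j ≤ m} C(2m+1, 2j+1) c^{2(m-j)} d^j`. -/
theorem cohnPell_im_pow_odd_eq_sum {d : ℤ} (c : ℤ) (m : ℕ) :
    ((⟨c, 1⟩ : ℤ√d) ^ (2 * m + 1)).im =
      ∑ j ∈ range (m + 1), ((2 * m + 1).choose (2 * j + 1) : ℤ) * c ^ (2 * (m - j)) * d ^ j := by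
  rw [cohnPell_im_pow_eq_sum, show 2 * m + 1 + 1 = 2 * (m + 1) by ring, cohnPell_sum_range_two_mul]
  refine sum_congr rfl fun j _ => ?_
  have h1 : ¬ Odd (2 * j) := by simp
  have h2 : Odd (2 * j + 1) := odd_two_mul_add_one j
  have h3 : (2 * j + 1) / 2 = j := by omega
  have h4 : 2 * m + 1 - (2 * j + 1) = 2 * (m - j) := by omega
  rw [if_neg h1, if_pos h2, h3, h4]
  ring

/-! ## The Pell equations `x² − (c²+1) y² = ± 1` -/

/-- For `d = c² + 1` with `c ≥ 1`, a solution of `x² − d y² = 1` with `x > 1` has `x ≥ 2c² + 1`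
(squeeze: for `1 ≤ |y| < 2c` one would have `(c|y|)² < x² < (c|y|+1)²`). -/
theorem cohnPell_x_lower_bound {c x y : ℤ} (hc : 1 ≤ c) (hx : 1 < x)
    (h : x ^ 2 - (c ^ 2 + 1) * y ^ 2 = 1) : 2 * c ^ 2 + 1 ≤ x := by
  have hy : y ≠ 0 := by rintro rfl; nlinarith
  set t := |y| with ht
  have ht0 : 0 < t := abs_pos.mpr hy
  have hty : t ^ 2 = y ^ 2 := sq_abs y
  have hx0 : 0 ≤ x := by linarith
  have hx2 : x ^ 2 = 1 + (c ^ 2 + 1) * t ^ 2 := by rw [hty]; linarith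
  have h2c : 2 * c ≤ t := by
    by_contra hlt
    push Not at hlt
    have h1 : (c * t) ^ 2 < x ^ 2 := by nlinarith
    have h2 : x ^ 2 < (c * t + 1) ^ 2 := by nlinarith [mul_pos ht0 (sub_pos.mpr hlt)]
    have h1' : c * t < x := lt_of_pow_lt_pow_left₀ 2 hx0 h1
    have h2' : x < c * t + 1 := lt_of_pow_lt_pow_left₀ 2 (by nlinarith) h2
    exact absurd (Int.lt_add_one_iff.mp h2') (not_le.mpr h1')
  have ht2 : (2 * c) ^ 2 ≤ t ^ 2 := pow_le_pow_left₀ (by linarith) h2c 2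
  have hsq : (2 * c ^ 2 + 1) ^ 2 ≤ x ^ 2 := by
    nlinarith [mul_nonneg (by positivity : (0 : ℤ) ≤ c ^ 2 + 1) (sub_nonneg.mpr ht2)]
  exact le_of_pow_le_pow_left₀ two_ne_zero hx0 hsq

/-- The fundamental solution of `x² − (c²+1) y² = 1` (`c ≥ 1`) is `(2c²+1, 2c) = (c + √(c²+1))²`. -/
theorem cohnPell_fundamental {c : ℤ} (hc : 1 ≤ c) :
    ∃ a₁ : Pell.Solution₁ (c ^ 2 + 1), Pell.IsFundamental a₁ ∧
      (a₁ : ℤ√(c ^ 2 + 1)) = ⟨2 * c ^ 2 + 1, 2 * c⟩ := by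
  refine ⟨Pell.Solution₁.mk (2 * c ^ 2 + 1) (2 * c) (by ring), ⟨?_, ?_, fun {b} hb => ?_⟩,
    Pell.Solution₁.coe_mk _ _ _⟩
  · rw [Pell.Solution₁.x_mk]; nlinarith
  · rw [Pell.Solution₁.y_mk]; linarith
  · rw [Pell.Solution₁.x_mk]
    exact cohnPell_x_lower_bound hc hb b.prop

/-- Structure of the negative Pell equation `y² − (c²+1) v² = −1` (`c ≥ 1`, `y ≥ 0`, `v ≥ 1`):
`y + v√(c²+1) = (c + √(c²+1))^{2m+1}` for some `m ≥ 0`. -/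
theorem cohnPell_neg_eq_pow {c y v : ℤ} (hc : 1 ≤ c) (hy : 0 ≤ y) (hv : 1 ≤ v)
    (h : y ^ 2 + 1 = (c ^ 2 + 1) * v ^ 2) :
    ∃ m : ℕ, (⟨y, v⟩ : ℤ√(c ^ 2 + 1)) = (⟨c, 1⟩ : ℤ√(c ^ 2 + 1)) ^ (2 * m + 1) := by
  obtain ⟨a₁, hfund, ha₁⟩ := cohnPell_fundamental hc
  -- the norm-`+1` companion `(y + v√d)(c + √d)`
  let b : Pell.Solution₁ (c ^ 2 + 1) :=
    Pell.Solution₁.mk (y * c + v * (c ^ 2 + 1)) (y + v * c) (by linear_combination (-1 : ℤ) * h)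
  have hbx : 0 < b.x := by
    show 0 < (Pell.Solution₁.mk _ _ _).x
    rw [Pell.Solution₁.x_mk]; nlinarith
  have hby : 0 ≤ b.y := by
    show 0 ≤ (Pell.Solution₁.mk _ _ _).y
    rw [Pell.Solution₁.y_mk]; nlinarith
  obtain ⟨n, hn⟩ := hfund.eq_pow_of_nonneg hbx hby
  -- `n ≠ 0` since `b.y = y + v c ≥ 1`
  obtain ⟨m, rfl⟩ : ∃ m, n = m + 1 := by
    rcases n with _ | m
    · exfalso
      have : b.y = 0 := by rw [hn, pow_zero, Pell.Solution₁.y_one]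
      have hby' : b.y = y + v * c := Pell.Solution₁.y_mk _ _ _
      nlinarith
    · exact ⟨m, rfl⟩
  refine ⟨m, ?_⟩
  -- pass to `ℤ√d`
  have hcoe : ∀ k : ℕ, ((a₁ ^ k : Pell.Solution₁ (c ^ 2 + 1)) : ℤ√(c ^ 2 + 1))
      = (a₁ : ℤ√(c ^ 2 + 1)) ^ k := fun k => by
    induction k with
    | zero => rfl
    | succ k ih =>
      rw [pow_succ (a := a₁), pow_succ (a := (a₁ : ℤ√(c ^ 2 + 1))), ← ih]; rfl
  have hb : (b : ℤ√(c ^ 2 + 1)) = ⟨y * c + v * (c ^ 2 + 1), y + v * c⟩ :=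
    Pell.Solution₁.coe_mk _ _ _
  have hbn : (b : ℤ√(c ^ 2 + 1)) = (a₁ : ℤ√(c ^ 2 + 1)) ^ (m + 1) := by rw [hn, hcoe]
  have hε2 : (a₁ : ℤ√(c ^ 2 + 1)) = (⟨c, 1⟩ : ℤ√(c ^ 2 + 1)) ^ 2 := by
    rw [ha₁]; ext <;> simp only [pow_two, re_mul, im_mul] <;> ring
  have hmul : (⟨y, v⟩ : ℤ√(c ^ 2 + 1)) * ⟨c, 1⟩ = ⟨y * c + v * (c ^ 2 + 1), y + v * c⟩ := by
    ext <;> simp only [re_mul, im_mul] <;> ring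
  have hinv : (⟨c, 1⟩ : ℤ√(c ^ 2 + 1)) * ⟨-c, 1⟩ = 1 := by
    ext <;> simp only [re_mul, im_mul, re_one, im_one] <;> ring
  calc (⟨y, v⟩ : ℤ√(c ^ 2 + 1))
      = (⟨y, v⟩ : ℤ√(c ^ 2 + 1)) * ⟨c, 1⟩ * ⟨-c, 1⟩ := by rw [mul_assoc, hinv, mul_one]
    _ = (⟨c, 1⟩ : ℤ√(c ^ 2 + 1)) ^ (2 * (m + 1)) * ⟨-c, 1⟩ := by
        rw [hmul, ← hb, hbn, hε2, ← pow_mul]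
    _ = (⟨c, 1⟩ : ℤ√(c ^ 2 + 1)) ^ (2 * m + 1) * (⟨c, 1⟩ * ⟨-c, 1⟩) := by
        rw [show 2 * (m + 1) = 2 * m + 1 + 1 by ring,
          pow_succ (a := (⟨c, 1⟩ : ℤ√(c ^ 2 + 1))) (n := 2 * m + 1), mul_assoc]
    _ = (⟨c, 1⟩ : ℤ√(c ^ 2 + 1)) ^ (2 * m + 1) := by rw [hinv, mul_one]

/-- **(B)** Cohn 1996, p. 20 l. 3–6: if `y² + 1 = (c²+1) v²` with `c, v ≥ 1`, then
`v = ∑_{j ≤ m} C(2m+1, 2j+1) c^{2(m−j)} (c²+1)^j` (`= Im (c + √(c²+1))^{2m+1}`) for some `m`. -/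
theorem cohn_negPell_structure {c v : ℕ} {y : ℤ} (hc : 1 ≤ c) (hv : 1 ≤ v)
    (h : y ^ 2 + 1 = ((c : ℤ) ^ 2 + 1) * (v : ℤ) ^ 2) :
    ∃ m : ℕ, v = ∑ j ∈ Finset.range (m + 1),
      (2 * m + 1).choose (2 * j + 1) * c ^ (2 * (m - j)) * (c ^ 2 + 1) ^ j := by
  have h' : |y| ^ 2 + 1 = ((c : ℤ) ^ 2 + 1) * (v : ℤ) ^ 2 := by rw [sq_abs]; exact h
  obtain ⟨m, hm⟩ := cohnPell_neg_eq_pow (c := (c : ℤ)) (by exact_mod_cast hc) (abs_nonneg y)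
    (by exact_mod_cast hv) h'
  refine ⟨m, ?_⟩
  have him := congrArg Zsqrtd.im hm
  rw [cohnPell_im_pow_odd_eq_sum] at him
  apply Nat.cast_injective (R := ℤ)
  push_cast
  exact him

/-! ## The size bound -/

/-- **(D)** Cohn 1996, p. 20 l. 12–13: for `m ≥ 1` (and `c, D ≥ 1`),
`2m+1 < ∑_{j ≤ m} C(2m+1, 2j+1) c^{2(m−j)} D^j` (the `j = 0` term is `(2m+1) c^{2m} ≥ 2m+1`,
the `j = m` term is `D^m ≥ 1`). -/
theorem cohn_index_lt_sum {c D m : ℕ} (hc : 1 ≤ c) (hD : 1 ≤ D) (hm : 1 ≤ m) :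
    2 * m + 1 < ∑ j ∈ Finset.range (m + 1),
      (2 * m + 1).choose (2 * j + 1) * c ^ (2 * (m - j)) * D ^ j := by
  rw [Finset.sum_range_succ]
  have h0 : 2 * m + 1 ≤ ∑ j ∈ Finset.range m,
      (2 * m + 1).choose (2 * j + 1) * c ^ (2 * (m - j)) * D ^ j := by
    have hmem : 0 ∈ Finset.range m := by simp; omega
    refine le_trans ?_ (Finset.single_le_sum
      (f := fun j => (2 * m + 1).choose (2 * j + 1) * c ^ (2 * (m - j)) * D ^ j)
      (fun _ _ => Nat.zero_le _) hmem)
    have h1 : 1 ≤ c ^ (2 * (m - 0)) := Nat.one_le_pow _ _ hc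
    simp only [mul_zero, zero_add, Nat.choose_one_right, pow_zero, mul_one]
    nlinarith
  have hlast : 1 ≤ (2 * m + 1).choose (2 * m + 1) * c ^ (2 * (m - m)) * D ^ m := by
    simp [Nat.one_le_pow _ _ hD]
  omega

/-! ## The `p`-adic comparison -/

/-- `2ν + 3 ≤ 5^ν` for `ν ≥ 1`. -/
theorem cohnPell_two_mul_add_three_le_five_pow {ν : ℕ} (hν : 1 ≤ ν) : 2 * ν + 3 ≤ 5 ^ ν := by
  induction ν with
  | zero => omega
  | succ n ih =>
    rcases Nat.eq_zero_or_pos n with rfl | hn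
    · norm_num
    · have := ih hn
      rw [pow_succ]; omega

/-- For a prime `p ≥ 5` and `i ≥ 1`: if `p^ν ∣ 2i+1` then `ν + 1 ≤ i`. -/
theorem cohnPell_padic_index_bound {p ν i : ℕ} (hp : 5 ≤ p) (hi : 1 ≤ i) (h : p ^ ν ∣ 2 * i + 1) :
    ν + 1 ≤ i := by
  rcases Nat.eq_zero_or_pos ν with rfl | hν
  · omega
  · have h1 := cohnPell_two_mul_add_three_le_five_pow hν
    have h2 : 5 ^ ν ≤ p ^ ν := Nat.pow_le_pow_left hp ν
    have h3 : p ^ ν ≤ 2 * i + 1 := Nat.le_of_dvd (by omega) h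
    omega

/-- `2z = c² + 1` forces `z` odd and `3 ∤ z`, so every prime factor of `z` is `≥ 5`. -/
theorem cohnPell_five_le_of_prime_dvd {c z p : ℕ} (hz : 2 * z = c ^ 2 + 1) (hp : p.Prime) (hpz : p ∣ z) :
    5 ≤ p := by
  refine hp.five_le_of_ne_two_of_ne_three ?_ ?_
  · rintro rfl
    obtain ⟨w, hw⟩ := hpz
    rcases Nat.even_or_odd c with ⟨t, rfl⟩ | ⟨t, rfl⟩
    · have : (t + t) ^ 2 = 4 * (t * t) := by ring
      omega
    · have : (2 * t + 1) ^ 2 = 4 * (t * t + t) + 1 := by ring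
      omega
  · rintro rfl
    obtain ⟨w, hw⟩ := hpz
    have h3 : c % 3 = 0 ∨ c % 3 = 1 ∨ c % 3 = 2 := by omega
    obtain ⟨s, hs⟩ : ∃ s, c = 3 * s + c % 3 := ⟨c / 3, by omega⟩
    rcases h3 with h3 | h3 | h3 <;> rw [h3] at hs
    · have : c ^ 2 = 3 * (3 * s * s) := by rw [hs]; ring
      omega
    · have : c ^ 2 = 3 * (3 * s * s + 2 * s) + 1 := by rw [hs]; ring
      omega
    · have : c ^ 2 = 3 * (3 * s * s + 4 * s + 1) + 1 := by rw [hs]; ring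
      omega

/-- The heart of the `p`-adic comparison (Cohn p. 20 l. 8–11): for a prime `p ≥ 5` with `p ∣ D`
and `p^e ∣ 2m+1`, every term `C(2m+1, 2i+1) c^{2(m−i)} D^i` with `i ≥ 1` is divisible by `p^{e+1}`
(because `(2i+1)·C(2m+1, 2i+1) = (2m+1)·C(2m, 2i)` and `v_p(2i+1) ≤ i − 1`). -/
theorem cohnPell_prime_pow_succ_dvd_term {p e m i c D : ℕ} (hp : p.Prime) (hp5 : 5 ≤ p) (hpD : p ∣ D)
    (he : p ^ e ∣ 2 * m + 1) (hi : 1 ≤ i) :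
    p ^ (e + 1) ∣ (2 * m + 1).choose (2 * i + 1) * c ^ (2 * (m - i)) * D ^ i := by
  -- factor `2i+1 = p^ν * r` with `p ∤ r`
  obtain ⟨ν, r, hr, hνr⟩ := Nat.exists_eq_pow_mul_and_not_dvd (n := 2 * i + 1) (by omega) p hp.one_lt.ne'
  have hνi : ν + 1 ≤ i := cohnPell_padic_index_bound hp5 hi ⟨r, hνr⟩
  -- `p^e ∣ (2m+1) C(2m,2i) = C(2m+1,2i+1) (2i+1) = C(2m+1,2i+1) p^ν r`
  have hkey : (2 * m + 1) * (2 * m).choose (2 * i) = (2 * m + 1).choose (2 * i + 1) * (2 * i + 1) :=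
    Nat.add_one_mul_choose_eq (2 * m) (2 * i)
  have h1 : p ^ e ∣ (2 * m + 1).choose (2 * i + 1) * p ^ ν * r := by
    have : p ^ e ∣ (2 * m + 1).choose (2 * i + 1) * (2 * i + 1) := hkey ▸ he.mul_right _
    rwa [show (2 * m + 1).choose (2 * i + 1) * (2 * i + 1)
        = (2 * m + 1).choose (2 * i + 1) * p ^ ν * r by rw [mul_assoc, ← hνr]] at this
  have hcop : Nat.Coprime (p ^ e) r := (hp.coprime_iff_not_dvd.mpr hr).pow_left e
  have h2 : p ^ e ∣ (2 * m + 1).choose (2 * i + 1) * p ^ ν := hcop.dvd_of_dvd_mul_right h1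
  have h3 : p ^ i ∣ D ^ i := pow_dvd_pow_of_dvd hpD i
  have h4 : p ^ e * p ^ i ∣ (2 * m + 1).choose (2 * i + 1) * p ^ ν * D ^ i := mul_dvd_mul h2 h3
  have h5 : p ^ (e + 1) * p ^ ν ∣ p ^ e * p ^ i := by
    rw [← pow_add, ← pow_add]; exact Nat.pow_dvd_pow p (by omega)
  have h6 : p ^ (e + 1) * p ^ ν ∣ (2 * m + 1).choose (2 * i + 1) * D ^ i * p ^ ν := by
    have := h5.trans h4
    rwa [mul_right_comm] at this
  have h7 : p ^ (e + 1) ∣ (2 * m + 1).choose (2 * i + 1) * D ^ i :=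
    Nat.dvd_of_mul_dvd_mul_right (pow_pos hp.pos ν) h6
  rw [mul_right_comm]
  exact h7.mul_right _

/-- **(C)** Cohn 1996, p. 20 l. 7–12: if `2z = c² + 1` and
`z^K = ∑_{j ≤ m} C(2m+1, 2j+1) c^{2(m−j)} (2z)^j`, then `z^K ∣ 2m+1` (for `K = 0` trivially). -/
theorem cohn_pow_dvd_index {c z K m : ℕ} (hz : 2 * z = c ^ 2 + 1)
    (hV : z ^ K = ∑ j ∈ Finset.range (m + 1),
      (2 * m + 1).choose (2 * j + 1) * c ^ (2 * (m - j)) * (2 * z) ^ j) :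
    z ^ K ∣ 2 * m + 1 := by
  refine (Nat.dvd_iff_prime_pow_dvd_dvd (2 * m + 1) (z ^ K)).2 fun p k hp hpk => ?_
  -- facts about `p` when `k ≥ 1`
  induction k with
  | zero => simp
  | succ e ih =>
    have hpe : p ^ e ∣ 2 * m + 1 := ih ((pow_dvd_pow p (Nat.le_succ e)).trans hpk)
    have hpz : p ∣ z := by
      have : p ∣ z ^ K := (dvd_pow_self p (Nat.succ_ne_zero e)).trans hpk
      exact hp.dvd_of_dvd_pow this
    have hp5 : 5 ≤ p := cohnPell_five_le_of_prime_dvd hz hp hpz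
    have hpD : p ∣ 2 * z := hpz.mul_left 2
    have hpc : Nat.Coprime (p ^ (e + 1)) (c ^ (2 * (m - 0))) := by
      apply Nat.Coprime.pow
      rw [hp.coprime_iff_not_dvd]
      intro hpc
      have h1 : p ∣ c ^ 2 + 1 := hz ▸ hpD
      have h2 : p ∣ c ^ 2 := dvd_pow hpc two_ne_zero
      have := (Nat.dvd_add_right h2).mp h1
      exact hp.one_lt.ne' (Nat.dvd_one.mp this)
    -- split off the `j = 0` term
    rw [Finset.sum_range_succ'] at hV
    have hrest : p ^ (e + 1) ∣ ∑ j ∈ Finset.range m,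
        (2 * m + 1).choose (2 * (j + 1) + 1) * c ^ (2 * (m - (j + 1))) * (2 * z) ^ (j + 1) :=
      Finset.dvd_sum fun j _ => cohnPell_prime_pow_succ_dvd_term hp hp5 hpD hpe (by omega)
    have h0 : p ^ (e + 1) ∣ (2 * m + 1).choose (2 * 0 + 1) * c ^ (2 * (m - 0)) * (2 * z) ^ 0 :=
      (Nat.dvd_add_right hrest).mp (hV ▸ hpk)
    rw [mul_zero, zero_add, Nat.choose_one_right, pow_zero, mul_one] at h0
    exact hpc.dvd_of_dvd_mul_right h0

end Summit.ABC.ABC.Theorems
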